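import Summits.AtomisticToContinuum.Crystallization.Theorems.ExcessDecayLiouvilleLongRangePaths
import Summits.AtomisticToContinuum.Crystallization.Theorems.ExcessDecayLiouvilleLongRangeWeights

/-!
# Route `ExcessDecayLiouville`: the localised long-range difference estimate (part III, assembly)

For the comparison step of item `ExcessDecay` (stmt-AtomisticToContinuum-9334), harmonic-replacement architecture:
for ANY displacement `v`, a centre `c`, `R ≥ 0` and a range `L ≥ 1`,

`Σ_{p ∈ S∩B_R} Σ_{q ∈ S∩B_{R+L}} [p≠q][|p−q| ≤ L] |p−q|⁻⁸ ‖v p − v q‖² ≤ 4·10⁶ · Σ_{p,q ∈ S∩B_{R′}} [p≠q][|p−q|≤11/10] ‖v p − v q‖²`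

with `R′ = R + 10L + 20` (`longRange_local_le`): every long bond is bridged by a nearest-neighbour path
(`ExcessDecayLiouvilleLongRangePaths.lean`), telescoped with Cauchy–Schwarz, and the resulting class weights
`d⁻⁸ n²` are summable over the bond classes (`ExcessDecayLiouvilleLongRangeWeights.lean`).  All sums are finite
(`Finset`s of the sites of closed balls).  All `[folklore]`; helper lemmas, nothing here closes an item.
-/

noncomputable section

namespace Summit.AtomisticToContinuum.Crystallization.Theorems.ExcessDecayLiouville

open scoped BigOperators Topology InnerProductSpace RealInnerProductSpace Classical
open Literature.MathematicalPhysics.StatisticalMechanics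
open Summit.AtomisticToContinuum.Crystallization.Theorems.PhononStabilityNegative
open Summit.AtomisticToContinuum.Crystallization.Theorems

-- lattice vector with integer coordinates
local notation "𝐳[" i ", " j ", " k "]" =>
  (((i : ℤ) : ℝ) • (triangularVec₁ 1 : EuclideanSpace ℝ (Fin 3)) + ((j : ℤ) : ℝ) • triangularVec₂ 1 +
    ((k : ℤ) : ℝ) • layerNormal (2 * Real.sqrt (2 / 3)))

-- the twelve moves `(m, m', Δζ)` (as in part I)
local notation "𝕄" => (({((0 : Fin 2), (0 : Fin 2), ((1 : ℤ), (0 : ℤ), (0 : ℤ))), (0, 0, (-1, 0, 0)), (0, 0, (0, 1, 0)), (0, 0, (0, -1, 0)),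
    (1, 1, (1, 0, 0)), (1, 1, (-1, 0, 0)), (1, 1, (0, 1, 0)), (1, 1, (0, -1, 0)),
    (0, 1, (0, 0, 0)), (1, 0, (0, 0, 0)), (1, 0, (0, 0, 1)), (0, 1, (0, 0, -1))} :
      Finset (Fin 2 × Fin 2 × ℤ × ℤ × ℤ)))

set_option quotPrecheck false in
local notation "Mv[" ℓ ", " ℓ' "]" => (((ℓ : Fin 2 × ℤ × ℤ × ℤ).1, (ℓ' : Fin 2 × ℤ × ℤ × ℤ).1,
  (ℓ' : Fin 2 × ℤ × ℤ × ℤ).2 - (ℓ : Fin 2 × ℤ × ℤ × ℤ).2) ∈ 𝕄)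

section

variable {t : Fin 2 → (EuclideanSpace ℝ (Fin 3))} {A : (EuclideanSpace ℝ (Fin 3)) →L[ℝ] (EuclideanSpace ℝ (Fin 3))}
  (hA : Adm₀ A) (hI : Inner₀ t A)

set_option quotPrecheck false in
-- nearest-neighbour energy of `v` on the sites of the closed ball of radius `X` about `c` (a finite double sum)
local notation "NN[" v ", " c ", " X "]" =>
  (∑ p ∈ (finite_sites_dist_le (t := t) (A := A) hA hI c X).toFinset,
    ∑ q ∈ (finite_sites_dist_le (t := t) (A := A) hA hI c X).toFinset,
      (if p ≠ q ∧ dist p q ≤ 11 / 10 then ‖v p - v q‖ ^ 2 else (0 : ℝ)))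

/-- The length of a bond class does not depend on the base point. [folklore] -/
theorem dist_class_eq (e : Fin 2 × ℤ × ℤ × ℤ ≃ Sites₀ t A)
    (he : ∀ m : Fin 2, ∀ i j k : ℤ, ((e (m, i, j, k) : Sites₀ t A) : EuclideanSpace ℝ (Fin 3)) = t m + A 𝐳[i, j, k])
    (m m' : Fin 2) (b ζ : ℤ × ℤ × ℤ) :
    dist ((e (m, b) : Sites₀ t A) : EuclideanSpace ℝ (Fin 3)) (e (m', b + ζ)) = dist (t m) (t m' + A 𝐳[ζ.1, ζ.2.1, ζ.2.2]) := by
  have h1 : ((e (m, b) : Sites₀ t A) : EuclideanSpace ℝ (Fin 3)) = t m + A 𝐳[b.1, b.2.1, b.2.2] := he m _ _ _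
  have h2 : ((e (m', b + ζ) : Sites₀ t A) : EuclideanSpace ℝ (Fin 3)) =
      t m' + (A 𝐳[b.1, b.2.1, b.2.2] + A 𝐳[ζ.1, ζ.2.1, ζ.2.2]) := by
    rw [he m', latticeVec_prod_add, map_add]
  rw [h1, h2, dist_eq_norm, dist_eq_norm]
  congr 1
  abel

/-- **Nearest-neighbour energies are monotone in the radius.** [folklore] -/
theorem nnEnergy_mono (v : (EuclideanSpace ℝ (Fin 3)) → (EuclideanSpace ℝ (Fin 3)))
    (c : EuclideanSpace ℝ (Fin 3)) {X Y : ℝ} (hXY : X ≤ Y) : NN[v, c, X] ≤ NN[v, c, Y] := by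
  have hsub : (finite_sites_dist_le (t := t) (A := A) hA hI c X).toFinset ⊆ (finite_sites_dist_le (t := t) (A := A) hA hI c Y).toFinset := by
    intro x hx
    rw [Set.Finite.mem_toFinset] at hx ⊢
    exact ⟨hx.1, hx.2.trans hXY⟩
  refine (Finset.sum_le_sum_of_subset_of_nonneg hsub fun p _ _ => Finset.sum_nonneg fun q _ => by split_ifs <;> positivity).trans ?_
  exact Finset.sum_le_sum fun p _ => Finset.sum_le_sum_of_subset_of_nonneg hsub fun q _ _ => by split_ifs <;> positivity

/-- **One bond class through its path** (step (c)): for a class `(m, m′, ζ)` and a finite set of base points `b`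
with `e(m,b)` in the ball of radius `R`, `Σ_b ‖v(e(m,b)) − v(e(m′,b+ζ))‖² ≤ n² · NN(R + 11n/10)`,
`n = |i|+|j|+2|k|+2`. [folklore] -/
theorem class_path_sum_le (e : Fin 2 × ℤ × ℤ × ℤ ≃ Sites₀ t A)
    (he : ∀ m : Fin 2, ∀ i j k : ℤ, ((e (m, i, j, k) : Sites₀ t A) : EuclideanSpace ℝ (Fin 3)) = t m + A 𝐳[i, j, k])
    (v : (EuclideanSpace ℝ (Fin 3)) → (EuclideanSpace ℝ (Fin 3))) (c : EuclideanSpace ℝ (Fin 3)) {R : ℝ}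
    (m m' : Fin 2) (ζ : ℤ × ℤ × ℤ) (Bset : Finset (ℤ × ℤ × ℤ))
    (hB : ∀ b ∈ Bset, dist ((e (m, b) : Sites₀ t A) : EuclideanSpace ℝ (Fin 3)) c ≤ R) :
    ∑ b ∈ Bset, ‖v (e (m, b) : Sites₀ t A) - v (e (m', b + ζ) : Sites₀ t A)‖ ^ 2 ≤
      ((ζ.1.natAbs + ζ.2.1.natAbs + 2 * ζ.2.2.natAbs + 2 : ℕ) : ℝ) ^ 2 *
        NN[v, c, R + 11 / 10 * ((ζ.1.natAbs + ζ.2.1.natAbs + 2 * ζ.2.2.natAbs + 2 : ℕ) : ℝ)] := by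
  classical
  obtain ⟨n, hn, γ, hγ0, hγn, hγ⟩ := exists_path m m' ζ.1 ζ.2.1 ζ.2.2
  set nb : ℕ := ζ.1.natAbs + ζ.2.1.natAbs + 2 * ζ.2.2.natAbs + 2 with hnb
  set R' : ℝ := R + 11 / 10 * (nb : ℝ) with hR'
  set SR' := (finite_sites_dist_le (t := t) (A := A) hA hI c R').toFinset with hSR'
  have hmem : ∀ x, x ∈ SR' ↔ x ∈ Sites₀ t A ∧ dist x c ≤ R' := fun x => by
    rw [hSR', Set.Finite.mem_toFinset]; rfl
  have hζ : ζ = (ζ.1, ζ.2.1, ζ.2.2) := by simp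
  -- telescoping
  have htel := sum_path_sq_le e v n γ Bset
  have hstart : ∀ b : ℤ × ℤ × ℤ, e ((γ 0).1, b + (γ 0).2) = e (m, b) := fun b => by
    rw [hγ0]; congr 1; ext <;> simp
  have hend : ∀ b : ℤ × ℤ × ℤ, e ((γ n).1, b + (γ n).2) = e (m', b + ζ) := fun b => by rw [hγn, ← hζ]
  simp only [hstart, hend] at htel
  refine htel.trans ?_
  -- each step sum is a sum over distinct NN pairs in the ball of radius R'
  have hstep : ∀ s ∈ Finset.range n,
      ∑ b ∈ Bset, ‖v (e ((γ s).1, b + (γ s).2) : Sites₀ t A) - v (e ((γ (s + 1)).1, b + (γ (s + 1)).2) : Sites₀ t A)‖ ^ 2 ≤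
        NN[v, c, R'] := by
    intro s hs
    rw [Finset.mem_range] at hs
    set φ : ℤ × ℤ × ℤ → (EuclideanSpace ℝ (Fin 3)) × (EuclideanSpace ℝ (Fin 3)) := fun b =>
      (((e ((γ s).1, b + (γ s).2) : Sites₀ t A) : EuclideanSpace ℝ (Fin 3)),
        ((e ((γ (s + 1)).1, b + (γ (s + 1)).2) : Sites₀ t A) : EuclideanSpace ℝ (Fin 3))) with hφ
    have hinj : Set.InjOn φ Bset := by
      intro b _ b' _ h
      have h1 : (e ((γ s).1, b + (γ s).2) : Sites₀ t A) = e ((γ s).1, b' + (γ s).2) :=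
        Subtype.ext (congrArg Prod.fst h)
      exact path_step_injective e (γ s) h1
    -- properties of the image pairs
    have hprop : ∀ b ∈ Bset, (φ b).1 ∈ SR' ∧ (φ b).2 ∈ SR' ∧ (φ b).1 ≠ (φ b).2 ∧ dist (φ b).1 (φ b).2 ≤ 11 / 10 := by
      intro b hb
      have hd1 := dist_path_le hA hI e he b hγ (s := s) hs.le
      have hd2 := dist_path_le hA hI e he b hγ (s := s + 1) (by omega)
      rw [hstart b] at hd1 hd2
      have hbR := hB b hb
      have hsn : (s : ℝ) + 1 ≤ nb := by
        have : s + 1 ≤ nb := by omega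
        exact_mod_cast this
      have hs' : (s : ℝ) ≤ nb := by linarith
      refine ⟨(hmem _).2 ⟨(e _).2, ?_⟩, (hmem _).2 ⟨(e _).2, ?_⟩, ?_, move_dist_le hA hI e he b (hγ s hs)⟩
      · have := dist_triangle ((e ((γ s).1, b + (γ s).2) : Sites₀ t A) : EuclideanSpace ℝ (Fin 3))
          ((e (m, b) : Sites₀ t A) : EuclideanSpace ℝ (Fin 3)) c
        nlinarith
      · have := dist_triangle ((e ((γ (s + 1)).1, b + (γ (s + 1)).2) : Sites₀ t A) : EuclideanSpace ℝ (Fin 3))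
          ((e (m, b) : Sites₀ t A) : EuclideanSpace ℝ (Fin 3)) c
        push_cast at hd2
        nlinarith
      · intro h
        have h' : (e ((γ s).1, b + (γ s).2) : Sites₀ t A) = e ((γ (s + 1)).1, b + (γ (s + 1)).2) := Subtype.ext h
        have h'' := e.injective h'
        have hne := ne_of_move (hγ s hs)
        apply hne
        obtain ⟨h1, h2⟩ := Prod.mk.inj h''
        exact Prod.ext h1 (add_left_cancel h2)
    -- compare the sums
    have hrhs : NN[v, c, R'] = ∑ x ∈ SR' ×ˢ SR', (if x.1 ≠ x.2 ∧ dist x.1 x.2 ≤ 11 / 10 then ‖v x.1 - v x.2‖ ^ 2 else (0 : ℝ)) := by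
      rw [hSR', Finset.sum_product]
    rw [hrhs]
    have himg : Bset.image φ ⊆ SR' ×ˢ SR' := by
      intro x hx
      rw [Finset.mem_image] at hx
      obtain ⟨b, hb, rfl⟩ := hx
      obtain ⟨h1, h2, -, -⟩ := hprop b hb
      exact Finset.mem_product.2 ⟨h1, h2⟩
    calc ∑ b ∈ Bset, ‖v (e ((γ s).1, b + (γ s).2) : Sites₀ t A) - v (e ((γ (s + 1)).1, b + (γ (s + 1)).2) : Sites₀ t A)‖ ^ 2
        = ∑ b ∈ Bset, (if (φ b).1 ≠ (φ b).2 ∧ dist (φ b).1 (φ b).2 ≤ 11 / 10 then ‖v (φ b).1 - v (φ b).2‖ ^ 2 else (0 : ℝ)) := by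
          refine Finset.sum_congr rfl fun b hb => ?_
          obtain ⟨-, -, h3, h4⟩ := hprop b hb
          rw [if_pos ⟨h3, h4⟩]
      _ = ∑ x ∈ Bset.image φ, (if x.1 ≠ x.2 ∧ dist x.1 x.2 ≤ 11 / 10 then ‖v x.1 - v x.2‖ ^ 2 else (0 : ℝ)) :=
          (Finset.sum_image (f := fun x : (EuclideanSpace ℝ (Fin 3)) × (EuclideanSpace ℝ (Fin 3)) =>
            (if x.1 ≠ x.2 ∧ dist x.1 x.2 ≤ 11 / 10 then ‖v x.1 - v x.2‖ ^ 2 else (0 : ℝ))) hinj).symm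
      _ ≤ ∑ x ∈ SR' ×ˢ SR', (if x.1 ≠ x.2 ∧ dist x.1 x.2 ≤ 11 / 10 then ‖v x.1 - v x.2‖ ^ 2 else (0 : ℝ)) :=
          Finset.sum_le_sum_of_subset_of_nonneg himg fun x _ _ => by split_ifs <;> positivity
  have hsum := Finset.sum_le_sum hstep
  simp only [Finset.sum_const, Finset.card_range, nsmul_eq_mul] at hsum
  have hn0 : (0 : ℝ) ≤ n := Nat.cast_nonneg _
  have hNN0 : 0 ≤ NN[v, c, R'] := Finset.sum_nonneg fun p _ => Finset.sum_nonneg fun q _ => by split_ifs <;> positivity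
  have hnle : (n : ℝ) ≤ nb := by exact_mod_cast hn
  calc (n : ℝ) * ∑ s ∈ Finset.range n, ∑ b ∈ Bset,
        ‖v (e ((γ s).1, b + (γ s).2) : Sites₀ t A) - v (e ((γ (s + 1)).1, b + (γ (s + 1)).2) : Sites₀ t A)‖ ^ 2
      ≤ (n : ℝ) * ((n : ℝ) * NN[v, c, R']) := mul_le_mul_of_nonneg_left hsum hn0
    _ = (n : ℝ) ^ 2 * NN[v, c, R'] := by ring
    _ ≤ (nb : ℝ) ^ 2 * NN[v, c, R'] := by gcongr

/-- **Step (a): the partners of a site within range `L` are labelled by a coordinate box.**  For a site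
`p = e(m,b)` and `N ≥ (400/189)(L + 11/10)`, the sum over the sites `q` of a ball of the range-`L` summand is at most
the same summand summed over the labels `(m′, b + ζ)`, `ζ` in the box of half-width `N`. [folklore] -/
theorem inner_sum_le_box (e : Fin 2 × ℤ × ℤ × ℤ ≃ Sites₀ t A)
    (he : ∀ m : Fin 2, ∀ i j k : ℤ, ((e (m, i, j, k) : Sites₀ t A) : EuclideanSpace ℝ (Fin 3)) = t m + A 𝐳[i, j, k])
    (v : (EuclideanSpace ℝ (Fin 3)) → (EuclideanSpace ℝ (Fin 3))) (c : EuclideanSpace ℝ (Fin 3)) (X : ℝ) {L : ℝ} {N : ℕ}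
    (hN : 400 / 189 * (L + 11 / 10) ≤ N) (m : Fin 2) (b : ℤ × ℤ × ℤ) :
    ∑ q ∈ (finite_sites_dist_le (t := t) (A := A) hA hI c X).toFinset,
        (if ((e (m, b) : Sites₀ t A) : EuclideanSpace ℝ (Fin 3)) ≠ q ∧ dist ((e (m, b) : Sites₀ t A) : EuclideanSpace ℝ (Fin 3)) q ≤ L then
          (dist ((e (m, b) : Sites₀ t A) : EuclideanSpace ℝ (Fin 3)) q)⁻¹ ^ 8 * ‖v (e (m, b) : Sites₀ t A) - v q‖ ^ 2 else (0 : ℝ)) ≤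
      ∑ m' : Fin 2, ∑ ζ ∈ (Finset.Icc (-(N : ℤ)) N) ×ˢ (Finset.Icc (-(N : ℤ)) N) ×ˢ (Finset.Icc (-(N : ℤ)) N),
        (if ((e (m, b) : Sites₀ t A) : EuclideanSpace ℝ (Fin 3)) ≠ (e (m', b + ζ) : Sites₀ t A) ∧
            dist ((e (m, b) : Sites₀ t A) : EuclideanSpace ℝ (Fin 3)) (e (m', b + ζ) : Sites₀ t A) ≤ L then
          (dist ((e (m, b) : Sites₀ t A) : EuclideanSpace ℝ (Fin 3)) (e (m', b + ζ) : Sites₀ t A))⁻¹ ^ 8 *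
            ‖v (e (m, b) : Sites₀ t A) - v (e (m', b + ζ) : Sites₀ t A)‖ ^ 2 else (0 : ℝ)) := by
  classical
  set p : EuclideanSpace ℝ (Fin 3) := ((e (m, b) : Sites₀ t A) : EuclideanSpace ℝ (Fin 3)) with hp
  set box := (Finset.Icc (-(N : ℤ)) N) ×ˢ (Finset.Icc (-(N : ℤ)) N) ×ˢ (Finset.Icc (-(N : ℤ)) N) with hbox
  set F : (EuclideanSpace ℝ (Fin 3)) → ℝ := fun q =>
    (if p ≠ q ∧ dist p q ≤ L then (dist p q)⁻¹ ^ 8 * ‖v p - v q‖ ^ 2 else (0 : ℝ)) with hF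
  set ψ : Fin 2 × ℤ × ℤ × ℤ → EuclideanSpace ℝ (Fin 3) := fun x => ((e (x.1, b + x.2) : Sites₀ t A) : EuclideanSpace ℝ (Fin 3)) with hψ
  have hinj : Set.InjOn ψ (((Finset.univ : Finset (Fin 2)) ×ˢ box : Finset (Fin 2 × ℤ × ℤ × ℤ)) : Set (Fin 2 × ℤ × ℤ × ℤ)) := by
    intro x _ y _ h
    have h1 : (e (x.1, b + x.2) : Sites₀ t A) = e (y.1, b + y.2) := Subtype.ext h
    have h2 := e.injective h1
    obtain ⟨h3, h4⟩ := Prod.mk.inj h2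
    exact Prod.ext h3 (add_left_cancel h4)
  have hF0 : ∀ q, 0 ≤ F q := fun q => by simp only [hF]; split_ifs <;> positivity
  set SX := (finite_sites_dist_le (t := t) (A := A) hA hI c X).toFinset with hSX
  -- every partner within range is in the image of the box
  have hcover : SX.filter (fun q => dist p q ≤ L) ⊆ ((Finset.univ : Finset (Fin 2)) ×ˢ box).image ψ := by
    intro q hq
    rw [Finset.mem_filter, hSX, Set.Finite.mem_toFinset] at hq
    obtain ⟨⟨hqS, -⟩, hqL⟩ := hq
    set ℓ := e.symm ⟨q, hqS⟩ with hℓ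
    have hqe : ((e (ℓ.1, ℓ.2) : Sites₀ t A) : EuclideanSpace ℝ (Fin 3)) = q := by
      simp [hℓ]
    set ζ : ℤ × ℤ × ℤ := ℓ.2 - b with hζ
    have hbζ : b + ζ = ℓ.2 := by rw [hζ]; abel
    rw [Finset.mem_image]
    refine ⟨(ℓ.1, ζ), Finset.mem_product.2 ⟨Finset.mem_univ _, ?_⟩, by rw [hψ]; simp only; rw [hbζ, hqe]⟩
    -- coordinate bounds
    have hAz : ‖A 𝐳[ζ.1, ζ.2.1, ζ.2.2]‖ ≤ L + 11 / 10 := by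
      have h1 : p = t m + A 𝐳[b.1, b.2.1, b.2.2] := he m _ _ _
      have h2 : q = t ℓ.1 + (A 𝐳[b.1, b.2.1, b.2.2] + A 𝐳[ζ.1, ζ.2.1, ζ.2.2]) := by
        rw [← hqe, ← hbζ, he ℓ.1, latticeVec_prod_add, map_add]
      have h3 : A 𝐳[ζ.1, ζ.2.1, ζ.2.2] = (q - p) - (t ℓ.1 - t m) := by rw [h1, h2]; abel
      rw [h3]
      have h4 : ‖q - p‖ ≤ L := by rw [← dist_eq_norm, dist_comm]; exact hqL
      have h5 : ‖t ℓ.1 - t m‖ ≤ 11 / 10 := by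
        have a := norm_t_sub_t_le hA hI
        have key : ∀ m₁ m₂ : Fin 2, ‖t m₁ - t m₂‖ ≤ 11 / 10 := by
          intro m₁ m₂
          fin_cases m₁ <;> fin_cases m₂
          · norm_num
          · simpa [norm_sub_rev] using a
          · simpa using a
          · norm_num
        exact key ℓ.1 m
      exact (norm_sub_le _ _).trans (by linarith)
    obtain ⟨c1, c2, c3⟩ := abs_coord_le_norm_apply_latticeVec hA ζ.1 ζ.2.1 ζ.2.2
    have hb1 : |(ζ.1 : ℝ)| ≤ N := by nlinarith
    have hb2 : |(ζ.2.1 : ℝ)| ≤ N := by nlinarith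
    have hb3 : |(ζ.2.2 : ℝ)| ≤ N := by nlinarith [norm_nonneg (A 𝐳[ζ.1, ζ.2.1, ζ.2.2])]
    have hb1' : |ζ.1| ≤ N := by exact_mod_cast hb1
    have hb2' : |ζ.2.1| ≤ N := by exact_mod_cast hb2
    have hb3' : |ζ.2.2| ≤ N := by exact_mod_cast hb3
    exact mem_box_iff.2 ⟨hb1', hb2', hb3'⟩
  calc ∑ q ∈ SX, F q = ∑ q ∈ SX.filter (fun q => dist p q ≤ L), F q := by
        rw [Finset.sum_filter]
        refine Finset.sum_congr rfl fun q _ => ?_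
        by_cases h : dist p q ≤ L
        · rw [if_pos h]
        · rw [if_neg h, hF]; simp only [h, and_false, if_false]
    _ ≤ ∑ q ∈ ((Finset.univ : Finset (Fin 2)) ×ˢ box).image ψ, F q :=
        Finset.sum_le_sum_of_subset_of_nonneg hcover fun q _ _ => hF0 q
    _ = ∑ x ∈ (Finset.univ : Finset (Fin 2)) ×ˢ box, F (ψ x) := Finset.sum_image hinj
    _ = ∑ m' : Fin 2, ∑ ζ ∈ box, F (ψ (m', ζ)) := Finset.sum_product _ _ _

/-- **The localised long-range difference estimate** (see the module docstring):
`Σ_{p ∈ S∩B_R} Σ_{q ∈ S∩B_{R+L}} [p≠q][|p−q|≤L] |p−q|⁻⁸‖v p − v q‖² ≤ 4·10⁶ · NN(R + 10L + 20)`. [folklore] -/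
theorem longRange_local_le (v : (EuclideanSpace ℝ (Fin 3)) → (EuclideanSpace ℝ (Fin 3))) (c : EuclideanSpace ℝ (Fin 3))
    {R L : ℝ} (hL : 1 ≤ L) :
    ∑ p ∈ (finite_sites_dist_le (t := t) (A := A) hA hI c R).toFinset,
      ∑ q ∈ (finite_sites_dist_le (t := t) (A := A) hA hI c (R + L)).toFinset,
        (if p ≠ q ∧ dist p q ≤ L then (dist p q)⁻¹ ^ 8 * ‖v p - v q‖ ^ 2 else (0 : ℝ)) ≤
      4000000 * NN[v, c, R + 10 * L + 20] := by
  classical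
  obtain ⟨e, he⟩ := exists_siteParam hA hI
  set N : ℕ := ⌈400 / 189 * (L + 11 / 10)⌉₊ with hNdef
  have hN : 400 / 189 * (L + 11 / 10) ≤ N := Nat.le_ceil _
  have hN' : (N : ℝ) ≤ 400 / 189 * (L + 11 / 10) + 1 := (Nat.ceil_lt_add_one (by positivity)).le
  set box := (Finset.Icc (-(N : ℤ)) N) ×ˢ (Finset.Icc (-(N : ℤ)) N) ×ˢ (Finset.Icc (-(N : ℤ)) N) with hbox
  set R' : ℝ := R + 10 * L + 20 with hR'
  set SR := (finite_sites_dist_le (t := t) (A := A) hA hI c R).toFinset with hSR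
  have hmemR : ∀ x, x ∈ SR ↔ x ∈ Sites₀ t A ∧ dist x c ≤ R := fun x => by rw [hSR, Set.Finite.mem_toFinset]; rfl
  set f : Fin 2 × ℤ × ℤ × ℤ → EuclideanSpace ℝ (Fin 3) := fun ℓ => ((e ℓ : Sites₀ t A) : EuclideanSpace ℝ (Fin 3)) with hf
  have hfinj : Function.Injective f := fun x y h => e.injective (Subtype.ext h)
  set PR := SR.preimage f hfinj.injOn with hPR
  have hmemPR : ∀ ℓ, ℓ ∈ PR ↔ f ℓ ∈ SR := fun ℓ => Finset.mem_preimage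
  -- the summand as a function of (p, q) and the class weight
  set F : (EuclideanSpace ℝ (Fin 3)) → (EuclideanSpace ℝ (Fin 3)) → ℝ := fun p q =>
    (if p ≠ q ∧ dist p q ≤ L then (dist p q)⁻¹ ^ 8 * ‖v p - v q‖ ^ 2 else (0 : ℝ)) with hF
  have hF0 : ∀ p q, 0 ≤ F p q := fun p q => by simp only [hF]; split_ifs <;> positivity
  set W : Fin 2 → Fin 2 → ℤ × ℤ × ℤ → ℝ := fun m m' ζ =>
    (if (m = m' ∧ ζ = 0) then (0 : ℝ) else
      (dist (t m) (t m' + A 𝐳[ζ.1, ζ.2.1, ζ.2.2]))⁻¹ ^ 8 * ((ζ.1.natAbs + ζ.2.1.natAbs + 2 * ζ.2.2.natAbs + 2 : ℕ) : ℝ) ^ 2) with hW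
  have hNN0 : 0 ≤ NN[v, c, R'] := Finset.sum_nonneg fun p _ => Finset.sum_nonneg fun q _ => by split_ifs <;> positivity
  -- (1) reindex the outer sum by labels and bound the inner sums by box sums
  have h1 : ∑ p ∈ SR, ∑ q ∈ (finite_sites_dist_le (t := t) (A := A) hA hI c (R + L)).toFinset, F p q ≤
      ∑ ℓ ∈ PR, ∑ m' : Fin 2, ∑ ζ ∈ box, F (f ℓ) (f (m', ℓ.2 + ζ)) := by
    rw [← Finset.sum_preimage f SR hfinj.injOn (fun p => ∑ q ∈ (finite_sites_dist_le (t := t) (A := A) hA hI c (R + L)).toFinset, F p q)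
      (fun p hp hpr => (hpr ⟨e.symm ⟨p, ((hmemR p).1 hp).1⟩, by simp [hf]⟩).elim)]
    refine Finset.sum_le_sum fun ℓ _ => ?_
    have := inner_sum_le_box hA hI e he v c (R + L) hN ℓ.1 ℓ.2
    simpa only [hf, Prod.mk.eta] using this
  -- (2) per class
  have hclass : ∀ (m m' : Fin 2) (ζ : ℤ × ℤ × ℤ), ζ ∈ box →
      ∑ ℓ ∈ PR with ℓ.1 = m, F (f ℓ) (f (m', ℓ.2 + ζ)) ≤ W m m' ζ * NN[v, c, R'] := by
    intro m m' ζ hζ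
    by_cases htriv : m = m' ∧ ζ = 0
    · obtain ⟨rfl, rfl⟩ := htriv
      have : ∀ ℓ ∈ PR.filter (fun ℓ => ℓ.1 = m), F (f ℓ) (f (m, ℓ.2 + 0)) = 0 := by
        intro ℓ hℓ
        rw [Finset.mem_filter] at hℓ
        have : f (m, ℓ.2 + 0) = f ℓ := by rw [add_zero, ← hℓ.2]
        rw [this, hF]; simp
      rw [Finset.sum_eq_zero this, hW]; simp
    · -- nontrivial class: through the path
      set Bset := (PR.filter (fun ℓ => ℓ.1 = m)).image Prod.snd with hBset
      have hinj : Set.InjOn Prod.snd ((PR.filter (fun ℓ => ℓ.1 = m) : Finset (Fin 2 × ℤ × ℤ × ℤ)) : Set (Fin 2 × ℤ × ℤ × ℤ)) := by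
        intro x hx y hy h
        rw [Finset.mem_coe, Finset.mem_filter] at hx hy
        exact Prod.ext (hx.2.trans hy.2.symm) h
      set d := dist (t m) (t m' + A 𝐳[ζ.1, ζ.2.1, ζ.2.2]) with hd
      set nb : ℕ := ζ.1.natAbs + ζ.2.1.natAbs + 2 * ζ.2.2.natAbs + 2 with hnb
      have hd0 : 0 < d := lt_of_lt_of_le (by norm_num) (classLen_ge hA hI htriv)
      -- termwise
      have hterm : ∀ ℓ ∈ PR.filter (fun ℓ => ℓ.1 = m), F (f ℓ) (f (m', ℓ.2 + ζ)) ≤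
          d⁻¹ ^ 8 * ‖v (e (m, ℓ.2) : Sites₀ t A) - v (e (m', ℓ.2 + ζ) : Sites₀ t A)‖ ^ 2 := by
        intro ℓ hℓ
        rw [Finset.mem_filter] at hℓ
        have hℓm : ℓ = (m, ℓ.2) := by rw [← hℓ.2]
        have hdist : dist (f ℓ) (f (m', ℓ.2 + ζ)) = d := by
          rw [hℓm]; exact dist_class_eq e he m m' ℓ.2 ζ
        simp only [hF]
        split_ifs with hc
        · rw [hdist, hℓm]
        · positivity
      have hBR : ∀ b ∈ Bset, dist ((e (m, b) : Sites₀ t A) : EuclideanSpace ℝ (Fin 3)) c ≤ R := by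
        intro b hb
        rw [hBset, Finset.mem_image] at hb
        obtain ⟨ℓ, hℓ, rfl⟩ := hb
        rw [Finset.mem_filter] at hℓ
        have hℓm : (m, ℓ.2) = ℓ := by rw [← hℓ.2]
        rw [hℓm]
        exact ((hmemR _).1 ((hmemPR ℓ).1 hℓ.1)).2
      have hpath := class_path_sum_le hA hI e he v c m m' ζ Bset hBR
      have hmono : NN[v, c, R + 11 / 10 * (nb : ℝ)] ≤ NN[v, c, R'] := by
        refine nnEnergy_mono hA hI v c ?_
        obtain ⟨b1, b2, b3⟩ := mem_box_iff.1 hζ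
        have : (nb : ℝ) ≤ 4 * N + 2 := by
          have e1 := Int.natCast_natAbs ζ.1
          have e2 := Int.natCast_natAbs ζ.2.1
          have e3 := Int.natCast_natAbs ζ.2.2
          have h : (nb : ℤ) ≤ 4 * N + 2 := by push_cast [hnb]; omega
          exact_mod_cast h
        rw [hR']
        nlinarith
      calc ∑ ℓ ∈ PR with ℓ.1 = m, F (f ℓ) (f (m', ℓ.2 + ζ))
          ≤ ∑ ℓ ∈ PR with ℓ.1 = m, d⁻¹ ^ 8 * ‖v (e (m, ℓ.2) : Sites₀ t A) - v (e (m', ℓ.2 + ζ) : Sites₀ t A)‖ ^ 2 :=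
            Finset.sum_le_sum hterm
        _ = d⁻¹ ^ 8 * ∑ b ∈ Bset, ‖v (e (m, b) : Sites₀ t A) - v (e (m', b + ζ) : Sites₀ t A)‖ ^ 2 := by
            rw [Finset.mul_sum, hBset, Finset.sum_image hinj]
        _ ≤ d⁻¹ ^ 8 * ((nb : ℝ) ^ 2 * NN[v, c, R + 11 / 10 * (nb : ℝ)]) :=
            mul_le_mul_of_nonneg_left hpath (by positivity)
        _ ≤ d⁻¹ ^ 8 * ((nb : ℝ) ^ 2 * NN[v, c, R']) := by gcongr
        _ = W m m' ζ * NN[v, c, R'] := by rw [hW]; simp only [if_neg htriv]; ring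
  -- (3) assemble
  calc ∑ p ∈ SR, ∑ q ∈ (finite_sites_dist_le (t := t) (A := A) hA hI c (R + L)).toFinset, F p q
      ≤ ∑ ℓ ∈ PR, ∑ m' : Fin 2, ∑ ζ ∈ box, F (f ℓ) (f (m', ℓ.2 + ζ)) := h1
    _ = ∑ m' : Fin 2, ∑ ζ ∈ box, ∑ ℓ ∈ PR, F (f ℓ) (f (m', ℓ.2 + ζ)) := by
        rw [Finset.sum_comm]
        exact Finset.sum_congr rfl fun m' _ => Finset.sum_comm
    _ = ∑ m' : Fin 2, ∑ ζ ∈ box, ∑ m : Fin 2, ∑ ℓ ∈ PR with ℓ.1 = m, F (f ℓ) (f (m', ℓ.2 + ζ)) := by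
        refine Finset.sum_congr rfl fun m' _ => Finset.sum_congr rfl fun ζ _ => ?_
        exact (Finset.sum_fiberwise PR Prod.fst _).symm
    _ ≤ ∑ m' : Fin 2, ∑ ζ ∈ box, ∑ m : Fin 2, W m m' ζ * NN[v, c, R'] :=
        Finset.sum_le_sum fun m' _ => Finset.sum_le_sum fun ζ hζ => Finset.sum_le_sum fun m _ => hclass m m' ζ hζ
    _ = (∑ m : Fin 2, ∑ m' : Fin 2, ∑ ζ ∈ box, W m m' ζ) * NN[v, c, R'] := by
        simp only [← Finset.sum_mul]
        congr 1
        calc ∑ m' : Fin 2, ∑ ζ ∈ box, ∑ m : Fin 2, W m m' ζ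
            = ∑ m' : Fin 2, ∑ m : Fin 2, ∑ ζ ∈ box, W m m' ζ := Finset.sum_congr rfl fun m' _ => Finset.sum_comm
          _ = ∑ m : Fin 2, ∑ m' : Fin 2, ∑ ζ ∈ box, W m m' ζ := Finset.sum_comm
    _ ≤ 4000000 * NN[v, c, R'] := mul_le_mul_of_nonneg_right (classWeight_sum_le hA hI N) hNN0

end

end Summit.AtomisticToContinuum.Crystallization.Theorems.ExcessDecayLiouville

end
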